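import Summits.CriticalPhenomena.CardyFormulaZ2.Theorems.CardySusyWardParafermionFamiliesToSLESixHalfCRVertexRelationPathwise
import Summits.CriticalPhenomena.CardyFormulaZ2.Theorems.CardySusyWardParafermionFamiliesToSLESixVertexCornerBridge
import Summits.CriticalPhenomena.CardyFormulaZ2.Theorems.CardySusyWardParafermionPrecompactFlipInvariance
import Summits.CriticalPhenomena.CardyFormulaZ2.Theorems.CardySusyWardParafermionFamiliesToSLESixDefs
import Literature.Probability.LatticeModels.InnerFacesHoleFree
import Literature.Probability.LatticeModels.MedialWindingBridge

/-!
# The half Cauchy–Riemann vertex relation of the spin-`1/3` corner observable (stub S2, assembly)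

Helper file for the crux `CardySusyWard.ParafermionFamiliesToSLESix` (stmt-CriticalPhenomena-10814),
line `strip-anchored-vertex-normalisation`, stub `stub_halfCRVertexRelation` (S2): Duminil-Copin 2012,
Prop. 4 / Duminil-Copin–Smirnov 2012, Prop. 8.6 at `q = 1`, `σ = 1/3`, for the tree's corner
observable `cornerObs` (`CardyComplexConeDefs.lean`) and the barrier file's clockwise corner table
`medialCornersAt` (`FKParafermionicHalfCauchyRiemann.lean`):

**Theorem** (`halfCRVertexRelation_of_holeFree`, registered one-line form `stub_halfCR_holeFree`).
For `ℤ²`-admissible Dobrushin data `E` WHOSE SET OF INNER FACES IS HOLE-FREE (e.g. `E.Ω` the carrier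
of a Jordan domain, `halfCRVertexRelation_of_jordan`), every interior medial vertex `p` (an edge of
`Ω_δ` off both arcs, both faces inner) and every reading mesh `δ > 0`:
`G(NW) - G(SE) = i · (G(NE) - G(SW))`, `G = cornerObs E δ` at the four corners of `p`.

The hole-freeness hypothesis is NECESSARY: for an admissible annular `E` (a `6 × 5` block of faces
with a `2 × 1` hole carrying the arc `A` on part of the hole's boundary) exact enumeration of the
`2¹⁷` configurations gives `G(NW) - G(SE) - χ (G(NE) - G(SW)) ≠ 0` at every interior vertex for both
`χ = ± i` (a loop of the loop representation winding around the hole touches the interface from the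
wrong side; at `q = 1` the loop phase `e^{∓ 2πi/3}` sees the orientation, unlike `q = 2`).

Proof.  Pair `ω` with `ω △ {e}` (`e` the lattice edge at `p`), a measure-preserving involution of
`P_{1/2}` (`integral_comp_symmDiff_singleton` of `CardySusyWardParafermionPrecompactFlipInvariance.lean`,
the same pairing step for the sibling crux `ParafermionPrecompact`).  Pathwise the
corner integrands are the dart weights `S2.dartW` of the cut orbit (`cornerIntegrand_explorationList`,
from S1's `cornerSum_explorationList`), the half-CR combination of the four integrands is `S2.gval`
(times `1` at a horizontal, `i` at a vertical vertex: the same coefficient serves both orientations),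
and `gval` is odd under the flip (`S2.gval_add_gval_toggle`, parts 1–3).  Hence its integral `J`
satisfies `J = -J`, and `J = G(NW) - G(SE) - i (G(NE) - G(SW))` by linearity (integrability:
`integrable_comp_medialExploration'` of S1).
-/

noncomputable section

namespace Summit.CriticalPhenomena.CardyFormulaZ2.Theorems.ParafermionFamiliesToSLESix.StripAnchored

open MeasureTheory Finset Complex
open scoped symmDiff
open Literature.Probability.Percolation (bondPercolation half BondConfig)
open Literature.Probability.LatticeModels
open Literature.Probability.LatticeModels.DiscreteDobrushin (startCorner exitTime isStartCorner_startCorner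
  medialExploration_eq_explorationList not_isInnerFace_exitTime isInnerFace_of_lt_exitTime)
open Literature.Barriers.CriticalPhenomena (medialCornersAt medialVertexOf HalfCRRelationAt)
open Summit.CriticalPhenomena.CardyFormulaZ2.Cruxes.EdgePrecompact.QkzStripBoundaryArm (cornerObs)

namespace S2

/-! ## The corner integrand along the cut orbit -/

/-- The integrand of `cornerObs E δ v f` as a functional of the exploration path `γ`: the sum over the
traversals of the dart `cornerSource v f → cornerTarget v f` of `exp(-(i/3) · winding of the prefix)`.
[cite: Smirnov2010, §2.2 eq. (2.2)] -/
def cornerIntegrand (δ : ℝ) (v f : Site 2) (γ : List MedialVertex) : ℂ :=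
  ∑ k ∈ (Finset.range γ.length).filter (fun k => γ[k]? = some (cornerSource v f) ∧ γ[k + 1]? = some (cornerTarget v f)),
    Complex.exp (-(Complex.I / 3) * ((Polyline.winding ((γ.map (medialPoint δ)).take (k + 2)) : ℝ) : ℂ))

/-- `cornerObs` is the expectation of `cornerIntegrand` of the exploration path. [folklore] -/
theorem cornerObs_eq_integral (E : DiscreteDobrushin) (δ : ℝ) (v f : Site 2) :
    cornerObs E δ v f = ∫ ω, cornerIntegrand δ v f (medialExploration E ω) ∂(bondPercolation (zdGraph 2) half) := by
  -- buildfix 2026-08-20 (proof-only, regime-robust): `cornerObs` spells the fully-qualified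
  -- `Literature.Probability.LatticeModels.winding`, which is `FermionicObservable`'s copy whenever that
  -- module is in the import closure, while `cornerIntegrand` uses `Polyline.winding`; bridge the two
  -- copies (`MedialWindingBridge`). Once the Literature dedupe lands both are one constant and `rfl` wins.
  first
    | rfl
    | (unfold cornerObs cornerIntegrand; simp only [Polyline.winding_eq_winding'])

/-- **Pathwise, the corner integrand at a coded corner `r` is its dart weight `dartW`.** [folklore] -/
theorem cornerIntegrand_explorationList {δ : ℝ} (hδ : δ ≠ 0) (β : BondConfig (Site 2)) (c₀ : Site 2 × Fin 4) (N : ℕ)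
    {r : Site 2 × Fin 4} {v f : Site 2} (h1 : r.1 = v) (h2 : cFace r = f) :
    cornerIntegrand δ v f (explorationList β c₀ N) = dartW β c₀ r N := by
  classical
  unfold cornerIntegrand
  rw [S1.cornerSum_explorationList hδ N v f, dartW, Finset.sum_filter]
  refine Finset.sum_congr rfl fun k _ => ?_
  have hs : cornerSource v f = cSrc r := S1.cornerSource_of_coded (c := (v, f)) h1 h2
  have ht : cornerTarget v f = cTgt r := S1.cornerTarget_of_coded (c := (v, f)) h1 h2
  rw [hs, ht]
  by_cases hk : cornerOrbit β c₀ k = r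
  · rw [if_pos ⟨by rw [hk], by rw [hk]⟩, if_pos hk, exp_turnOf_eq_sixthPhase]
  · rw [if_neg (fun h => hk (eq_of_cSrc_eq_of_cTgt_eq h.1 h.2)), if_neg hk]

/-! ## The four corners of a medial vertex, in coded form -/

/-- The canonical arriving corner at the medial vertex `s(x, x + eᵢ)`: `(x, 3)` (horizontal, the `SW`
corner) resp. `(x, 0)` (vertical, the `SE` corner); its target edge is the medial vertex. [folklore] -/
def baseCorner (p : Site 2 × Fin 2) : Site 2 × Fin 4 := (p.1, ![3, 0] p.2)

/-- The target edge of the base corner is the medial vertex. [folklore] -/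
theorem cTgt_baseCorner (p : Site 2 × Fin 2) : cTgt (baseCorner p) = medialVertexOf p := by
  obtain ⟨x, i⟩ := p
  fin_cases i <;> simp [baseCorner, cTgt, medialVertexOf, cornerUnit]

/-- The other endpoint of the medial vertex is the vertex of the partner of the base corner. [folklore] -/
theorem fst_add_single_eq (p : Site 2 × Fin 2) :
    p.1 + Pi.single p.2 1 = (baseCorner p).1 + cornerUnit ((baseCorner p).2 + 1) := by
  obtain ⟨x, i⟩ := p
  fin_cases i <;> simp [baseCorner, cornerUnit]

/-- The four corners `NW, NE, SE, SW` of `medialCornersAt`, coded, in terms of the base corner `q`,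
its partner `q₂` and their cross-successors `q⁺ = (q.1, q.2 + 1)`, `q₂⁺`: horizontal
`NW, NE, SE, SW = q⁺, q₂, q₂⁺, q`, vertical `= q₂, q₂⁺, q, q⁺`. [folklore] -/
def codedCornerAt (p : Site 2 × Fin 2) : Fin 4 → Site 2 × Fin 4 :=
  match p.2 with
  | 0 => ![((baseCorner p).1, (baseCorner p).2 + 1), cornerPartner (baseCorner p),
      ((cornerPartner (baseCorner p)).1, (cornerPartner (baseCorner p)).2 + 1), baseCorner p]
  | 1 => ![cornerPartner (baseCorner p), ((cornerPartner (baseCorner p)).1, (cornerPartner (baseCorner p)).2 + 1),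
      baseCorner p, ((baseCorner p).1, (baseCorner p).2 + 1)]

/-- The coded corners have the vertices and faces of the table `medialCornersAt`. [folklore] -/
theorem codedCornerAt_spec (p : Site 2 × Fin 2) (k : Fin 4) :
    (codedCornerAt p k).1 = (medialCornersAt p.1 p.2 k).1 ∧ cFace (codedCornerAt p k) = (medialCornersAt p.1 p.2 k).2 := by
  obtain ⟨x, i⟩ := p
  fin_cases i <;> fin_cases k <;>
    (simp [codedCornerAt, baseCorner, cornerPartner, medialCornersAt, cFace, faceAt, cornerOff, cornerUnit]; try abel)

/-- **The half-CR combination of the four coded corners is `gval` at the base corner**, times `1` at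
a horizontal and `i` at a vertical medial vertex (rotation covariance: `-1/i = i`). [folklore] -/
theorem comb_codedCornerAt (p : Site 2 × Fin 2) (F : Site 2 × Fin 4 → ℂ) :
    F (codedCornerAt p 0) - F (codedCornerAt p 2) - I * (F (codedCornerAt p 1) - F (codedCornerAt p 3)) =
      ![(1 : ℂ), I] p.2 * (F ((baseCorner p).1, (baseCorner p).2 + 1) -
        F ((cornerPartner (baseCorner p)).1, (cornerPartner (baseCorner p)).2 + 1) -
        I * (F (cornerPartner (baseCorner p)) - F (baseCorner p))) := by
  obtain ⟨x, i⟩ := p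
  fin_cases i
  · simp [codedCornerAt]
  · simp only [codedCornerAt, Fin.mk_one, Fin.isValue, Matrix.cons_val_zero, Matrix.cons_val_one, Matrix.cons_val_two,
      Matrix.cons_val_three, Matrix.cons_val_fin_one, Matrix.head_cons, Matrix.tail_cons]
    linear_combination (F (cornerPartner (baseCorner (x, 1))) - F (baseCorner (x, 1))) * Complex.I_mul_I

/-! ## The theorem -/

/-- Interior medial vertices of admissible data: all four faces at both endpoints are inner, and no
endpoint lies on the arc `B`. [cite: Smirnov2001, §2] -/
theorem interior_faces {E : DiscreteDobrushin} (hE : E.IsZdAdmissible) {q : Site 2 × Fin 4}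
    (harc : ∀ x ∈ cTgt q, x ∉ E.zdArcA ∧ x ∉ E.zdArcB) (hf : E.IsInnerFace (cFace q)) :
    (∀ j, E.IsInnerFace (faceAt q.1 j)) ∧ (∀ j, E.IsInnerFace (faceAt (q.1 + cornerUnit (q.2 + 1)) j)) := by
  have hnb : ∀ x ∈ cTgt q, x ∉ E.zdBoundary := fun x hx h => by
    rcases hE.zdBoundary_subset h with h | h
    · exact (harc x hx).1 h
    · exact (harc x hx).2 h
  constructor
  · rcases E.faces_dichotomy (hnb q.1 (Sym2.mem_mk_left _ _)) with h | h
    · exact h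
    · exact absurd hf (h q.2)
  · rcases E.faces_dichotomy (hnb _ (Sym2.mem_mk_right _ _)) with h | h
    · exact h
    · refine absurd ?_ (h (q.2 + 1 + 2))
      rw [faceAt_add_unit_add_two, fin4_add_one_add_three]
      exact hf

/-- **The half Cauchy–Riemann vertex relation at `q = 1`, `σ = 1/3`** (Duminil-Copin 2012, Prop. 4;
Duminil-Copin–Smirnov 2012, Prop. 8.6), for `ℤ²`-admissible Dobrushin data with HOLE-FREE inner faces:
at every interior medial vertex `p` and every reading mesh `δ > 0`,
`G(NW) - G(SE) = i (G(NE) - G(SW))` for `G = cornerObs E δ` at the corners `medialCornersAt`.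
[cite: DuminilCopin2012Parafermion, Proposition 4] [cite: DuminilCopinSmirnov2012Lattice, Proposition 8.6] -/
theorem halfCRVertexRelation_of_holeFree (E : DiscreteDobrushin) (hE : E.IsZdAdmissible)
    (hH : HoleFree {f : Site 2 | E.IsInnerFace f}) (p : Site 2 × Fin 2)
    (he : medialVertexOf p ∈ (discreteDomainGraph E.Ω E.δ).edgeSet)
    (harc : ∀ x ∈ medialVertexOf p, x ∉ E.zdArcA ∧ x ∉ E.zdArcB)
    (hf : ∀ f : Site 2, IsCorner p.1 f → IsCorner (p.1 + Pi.single p.2 1) f → E.IsInnerFace f)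
    (δ : ℝ) (hδ : 0 < δ) :
    HalfCRRelationAt I (fun c : Site 2 × Site 2 => cornerObs E δ c.1 c.2) p := by
  classical
  set q := baseCorner p with hqdef
  set e := medialVertexOf p with hedef
  have hq : cTgt q = e := cTgt_baseCorner p
  set c₀ := startCorner hE with hc₀def
  set P := bondPercolation (zdGraph 2) half with hPdef
  -- interior data
  have harc' : ∀ x ∈ cTgt q, x ∉ E.zdArcA ∧ x ∉ E.zdArcB := by rw [hq]; exact harc
  have hB : ∀ x ∈ cTgt q, x ∉ E.zdArcB := fun x hx => (harc' x hx).2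
  have hfq : E.IsInnerFace (cFace q) := by
    refine hf _ (isCorner_cFace q) ?_
    rw [fst_add_single_eq p]
    exact (isCorner_add_faceAt_iff q.1 (q.2 + 1) q.2).2 (Or.inr (fin4_add_one_add_three q.2).symm)
  obtain ⟨hx, hy⟩ := interior_faces hE harc' hfq
  -- toggling `e` toggles the completed configuration at `e` only
  have hez : e ∈ (zdGraph 2).edgeSet := by rw [← hq]; exact cTgt_mem_edgeSet q
  have htog : ∀ ω : BondConfig (Site 2),
      (∀ e', e' ≠ cTgt q → (e' ∈ E.bcBondConfig (ω ∆ {e}) ↔ e' ∈ E.bcBondConfig ω)) ∧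
      ¬ (cTgt q ∈ E.bcBondConfig (ω ∆ {e}) ↔ cTgt q ∈ E.bcBondConfig ω) := by
    intro ω
    refine ⟨fun e' he' => ?_, fun h => ?_⟩
    · simp only [DiscreteDobrushin.mem_bcBondConfig_iff, Set.mem_symmDiff, Set.mem_singleton_iff, hq] at he' ⊢
      tauto
    · rw [hq] at h
      simp only [DiscreteDobrushin.mem_bcBondConfig_iff, Set.mem_symmDiff, Set.mem_singleton_iff,
        not_true, and_false, true_and, false_or] at h
      have hA : ¬ ∀ x ∈ e, x ∈ E.zdArcA := fun h' => (harc _ (Sym2.mem_mk_left _ _)).1 (h' _ (Sym2.mem_mk_left _ _))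
      have hB' : ∀ x ∈ e, x ∉ E.zdArcB := fun x hx => (harc x hx).2
      tauto
  -- the integrands
  set Φ : Fin 4 → List MedialVertex → ℂ := fun k γ => cornerIntegrand δ (medialCornersAt p.1 p.2 k).1 (medialCornersAt p.1 p.2 k).2 γ
    with hΦ
  have hΦW : ∀ (ω : BondConfig (Site 2)) (k : Fin 4), Φ k (medialExploration E ω) =
      dartW (E.bcBondConfig ω) c₀ (codedCornerAt p k) (exitTime hE ω) := by
    intro ω k
    simp only [hΦ]
    rw [medialExploration_eq_explorationList hE ω]
    exact cornerIntegrand_explorationList hδ.ne' _ _ _ (codedCornerAt_spec p k).1 (codedCornerAt_spec p k).2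
  set Ψ : List MedialVertex → ℂ := fun γ => Φ 0 γ - Φ 2 γ - I * (Φ 1 γ - Φ 3 γ) with hΨ
  have hΨg : ∀ ω : BondConfig (Site 2), Ψ (medialExploration E ω) =
      ![(1 : ℂ), I] p.2 * gval (E.bcBondConfig ω) c₀ q (exitTime hE ω) := by
    intro ω
    show Φ 0 _ - Φ 2 _ - I * (Φ 1 _ - Φ 3 _) = _
    have hc := comb_codedCornerAt p (fun r => dartW (E.bcBondConfig ω) c₀ r (exitTime hE ω))
    rw [hΦW, hΦW, hΦW, hΦW, hc, hqdef]
    rfl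
  -- oddness under the flip
  have hodd : ∀ ω : BondConfig (Site 2), Ψ (medialExploration E (ω ∆ {e})) = -Ψ (medialExploration E ω) := by
    intro ω
    obtain ⟨hagree, hdiff⟩ := htog ω
    have h := gval_add_gval_toggle hE hH hx hy hB hagree hdiff
    rw [hΨg, hΨg, eq_neg_iff_add_eq_zero, ← mul_add, add_comm, h, mul_zero]
  -- the integral of `Ψ ∘ exploration` vanishes
  have hJ : ∫ ω, Ψ (medialExploration E ω) ∂P = 0 := by
    have h1 : ∫ ω, Ψ (medialExploration E (ω ∆ {e})) ∂P = ∫ ω, Ψ (medialExploration E ω) ∂P :=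
      Summit.CriticalPhenomena.CardyFormulaZ2.Cruxes.ParafermionPrecompact.KenyonStreamSecondRelation.integral_comp_symmDiff_singleton
        hez (fun ω => Ψ (medialExploration E ω))
    simp_rw [hodd, integral_neg] at h1
    linear_combination -(h1 / 2)
  -- linearity
  have hint : ∀ k, Integrable (fun ω => Φ k (medialExploration E ω)) P := fun k =>
    S1.integrable_comp_medialExploration' hE (Φ k)
  have hG : ∀ k, cornerObs E δ (medialCornersAt p.1 p.2 k).1 (medialCornersAt p.1 p.2 k).2 =
      ∫ ω, Φ k (medialExploration E ω) ∂P := fun k => cornerObs_eq_integral E δ _ _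
  have e1 : ∫ ω, (Φ 0 (medialExploration E ω) - Φ 2 (medialExploration E ω) -
      I * (Φ 1 (medialExploration E ω) - Φ 3 (medialExploration E ω))) ∂P =
      (∫ ω, (Φ 0 (medialExploration E ω) - Φ 2 (medialExploration E ω)) ∂P) -
        ∫ ω, I * (Φ 1 (medialExploration E ω) - Φ 3 (medialExploration E ω)) ∂P :=
    integral_sub ((hint 0).sub (hint 2)) (((hint 1).sub (hint 3)).const_mul I)
  have e2 : ∫ ω, (Φ 0 (medialExploration E ω) - Φ 2 (medialExploration E ω)) ∂P =
      (∫ ω, Φ 0 (medialExploration E ω) ∂P) - ∫ ω, Φ 2 (medialExploration E ω) ∂P := integral_sub (hint 0) (hint 2)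
  have e3 : ∫ ω, I * (Φ 1 (medialExploration E ω) - Φ 3 (medialExploration E ω)) ∂P =
      I * ∫ ω, (Φ 1 (medialExploration E ω) - Φ 3 (medialExploration E ω)) ∂P := integral_const_mul _ _
  have e4 : ∫ ω, (Φ 1 (medialExploration E ω) - Φ 3 (medialExploration E ω)) ∂P =
      (∫ ω, Φ 1 (medialExploration E ω) ∂P) - ∫ ω, Φ 3 (medialExploration E ω) ∂P := integral_sub (hint 1) (hint 3)
  simp only [hΨ] at hJ
  rw [e1, e2, e3, e4] at hJ
  unfold HalfCRRelationAt
  simp only [hG]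
  linear_combination hJ

/-- **The half-CR vertex relation for discretisations of Jordan domains** (the inner faces of the
discretisation of a Jordan domain are hole-free, `holeFree_innerFaces`). [cite: DuminilCopin2012Parafermion, Proposition 4] -/
theorem halfCRVertexRelation_of_jordan (D : Literature.Probability.RandomPlanarGeometry.JordanDomain)
    (E : DiscreteDobrushin) (hΩ : E.Ω = D.carrier) (hE : E.IsZdAdmissible) (p : Site 2 × Fin 2)
    (he : medialVertexOf p ∈ (discreteDomainGraph E.Ω E.δ).edgeSet)
    (harc : ∀ x ∈ medialVertexOf p, x ∉ E.zdArcA ∧ x ∉ E.zdArcB)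
    (hf : ∀ f : Site 2, IsCorner p.1 f → IsCorner (p.1 + Pi.single p.2 1) f → E.IsInnerFace f)
    (δ : ℝ) (hδ : 0 < δ) :
    HalfCRRelationAt I (fun c : Site 2 × Site 2 => cornerObs E δ c.1 c.2) p :=
  halfCRVertexRelation_of_holeFree E hE (holeFree_innerFaces D hΩ hE.delta_pos) p he harc hf δ hδ

end S2

/-- **(S2, corrected), registered one-line form** (sub-goal `stub_halfCR_holeFree` of
stmt-CriticalPhenomena-10814): the skeleton's `∃ χ ∈ {i, -i}, HalfCRVertexRelation χ` with the
NECESSARY extra hypothesis that the inner faces of `E` be hole-free (discharged for the line's families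
`Λ δ`, whose domains are carriers of Dobrushin domains, by `holeFree_innerFaces`), `IsInteriorMV`
unfolded; `χ = i` in the barrier file's clockwise indexing. [cite: DuminilCopin2012Parafermion, Proposition 4] -/
theorem stub_halfCR_holeFree : ∃ χ : ℂ, (χ = Complex.I ∨ χ = -Complex.I) ∧ ∀ (E : DiscreteDobrushin), E.IsZdAdmissible → HoleFree {f : Site 2 | E.IsInnerFace f} → ∀ p : Site 2 × Fin 2, (medialVertexOf p ∈ (discreteDomainGraph E.Ω E.δ).edgeSet ∧ (∀ x ∈ medialVertexOf p, x ∉ E.zdArcA ∧ x ∉ E.zdArcB) ∧ ∀ f : Site 2, IsCorner p.1 f → IsCorner (p.1 + Pi.single p.2 1) f → E.IsInnerFace f) → ∀ δ : ℝ, 0 < δ → HalfCRRelationAt χ (fun c : Site 2 × Site 2 => cornerObs E δ c.1 c.2) p :=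
  ⟨Complex.I, Or.inl rfl, fun E hE hH p hp δ hδ => S2.halfCRVertexRelation_of_holeFree E hE hH p hp.1 hp.2.1 hp.2.2 δ hδ⟩

/-- **(S2, corrected) over the line's vocabulary** (`IsInteriorMV` of the Defs module; the skeleton's
`HalfCRVertexRelation χ` with the hole-freeness hypothesis inserted after admissibility).
[cite: DuminilCopin2012Parafermion, Proposition 4] -/
theorem halfCRVertexRelation_holeFree : ∃ χ : ℂ, (χ = Complex.I ∨ χ = -Complex.I) ∧
    ∀ (E : DiscreteDobrushin), E.IsZdAdmissible → HoleFree {f : Site 2 | E.IsInnerFace f} →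
      ∀ p : Site 2 × Fin 2, IsInteriorMV E p → ∀ δ : ℝ, 0 < δ →
        HalfCRRelationAt χ (fun c : Site 2 × Site 2 => cornerObs E δ c.1 c.2) p :=
  stub_halfCR_holeFree

/-- **(S2, corrected) for discretisations of a Dobrushin (Jordan) domain** — the form the line consumes
(`IsFamily D Λ` gives `(Λ δ).Ω = D.carrier`): `χ = i`. [cite: DuminilCopin2012Parafermion, Proposition 4] -/
theorem halfCRVertexRelation_of_dobrushinDomain (D : Literature.Probability.RandomPlanarGeometry.DobrushinDomain)
    (E : DiscreteDobrushin) (hΩ : E.Ω = D.carrier) (hE : E.IsZdAdmissible) (p : Site 2 × Fin 2)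
    (hp : IsInteriorMV E p) (δ : ℝ) (hδ : 0 < δ) :
    HalfCRRelationAt Complex.I (fun c : Site 2 × Site 2 => cornerObs E δ c.1 c.2) p :=
  S2.halfCRVertexRelation_of_holeFree E hE (holeFree_innerFaces D.toJordanDomain hΩ hE.delta_pos) p hp.1 hp.2.1 hp.2.2 δ hδ

end Summit.CriticalPhenomena.CardyFormulaZ2.Theorems.ParafermionFamiliesToSLESix.StripAnchored

end
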